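import Literature.MeasureTheory.Moments.TruncatedMomentProblem

/-!
# Proof of Fialkow–Nie 2010, Theorem 1.3 (`FialkowNie2010_thm13_holds`)

L. Fialkow, J. Nie, *Positivity of Riesz functionals and solutions of quadratic and quartic moment
problems*, J. Funct. Anal. **258** (2010) 328–356 (arXiv:0908.3230), §2.

This file discharges the named fact `Literature.MeasureTheory.Moments.FialkowNie2010_thm13`
(stated in `TruncatedMomentProblem.lean`) by formalizing the proof printed in §2 of the source:
Lemma 2.1 (a convex set in `ℝ^N` and its closure have the same interior), Theorem 2.2 (i ⇒ iii)
(`K`-positivity of `L_y` puts `y` in the closure of the cone `𝓡_{n,k}(K)` of sequences with a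
`K`-representing measure — Minkowski separation), Lemma 2.3 (for a determining `K`, strict
`K`-positivity is an open condition — compactness), Theorem 2.4 (= Theorem 1.3:
`y ∈ int cl 𝓡 = int 𝓡 ⊆ 𝓡`). The Bayer–Teichmann theorem (finitely atomic measures) is not
needed and not used: as in the source, Theorem 2.2 is proved for the cone of ALL representing
measures. Everything is proved from Mathlib; no definitions are introduced (the cone, the
monomial vector and the set of `K`-non-negative coefficient vectors are local notations).
-/

namespace Literature.MeasureTheory.Moments

open _root_.MeasureTheory

/-! ## The argument (op. cit. §2: Lemma 2.1, Theorem 2.2, Lemma 2.3, Theorem 2.4)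

We follow the printed proof (arXiv:0908.3230, §2). Fix `n`, a finite set `T` of multi-indices (in
the end: all `α` with `|α| ≤ k`) and `K ⊆ ℝⁿ`; truncated moment sequences live in `V = ℝ^T`.
* `𝓡 ⊆ V` (local notation) is the cone `𝓡_{n,k}(K)` of sequences having a `K`-representing
  measure; it is convex, contains `0` and the monomial vectors `[x]_k` (`x ∈ K`, Dirac measures).
* (Thm. 2.2, i ⇒ iii) a `K`-positive sequence lies in the CLOSURE of `𝓡` — Minkowski separation
  from a closed convex cone (`geometric_hahn_banach_point_closed`).
* (Lemma 2.3) for determining `K`, strict `K`-positivity is an open condition — compactness of the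
  `K`-non-negative coefficient vectors of norm one (tube-lemma form of the printed `2ε`-argument).
* (Lemma 2.1) a convex set in `ℝ^T` and its closure have the same interior
  (`Convex.interior_closure_eq_interior_of_nonempty_interior` + affine spans), whence (Thm. 2.4)
  `y ∈ int cl 𝓡 = int 𝓡 ⊆ 𝓡`.
Polynomials enter only through the dictionary `c ↦ Σ_{α ∈ T} c_α x^α` between coefficient vectors
`c ∈ V` and `𝒫_k` (degree, evaluation, Riesz functional, injectivity). No auxiliary definitions:
the objects above are local notations (`notation3`), so this file declares no new definition. -/

section FialkowNieProof

open _root_.Filter Metric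
open scoped _root_.Topology

variable {n : ℕ} {T : Finset (Fin n →₀ ℕ)} {K : Set (Fin n → ℝ)}

-- `𝐯[x]` : the monomial vector `[x]_T = (x^α)_{α ∈ T} ∈ ℝ^T` of a point `x ∈ ℝⁿ`.
local notation3 "𝐯[" x "]" => fun α : ↥T => ∏ i, (x : Fin n → ℝ) i ^ (α.1 i)

-- `𝓡` : the cone `𝓡_{n,k}(K)` (sequences indexed by `T` with a `K`-representing measure).
local notation3 "𝓡" => {w : ↥T → ℝ | ∃ μ : Measure (Fin n → ℝ), μ Kᶜ = 0 ∧ ∀ α : ↥T,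
    Integrable (fun x : Fin n → ℝ => ∏ i, x i ^ (α.1 i)) μ ∧ ∫ x, ∏ i, x i ^ (α.1 i) ∂μ = w α}

-- `𝓒` : coefficient vectors `c ∈ ℝ^T` of polynomials `Σ c_α x^α` non-negative on `K`.
local notation3 "𝓒" => {c : ↥T → ℝ | ∀ x ∈ K, 0 ≤ c ⬝ᵥ 𝐯[x]}

/-- `0 ∈ 𝓡_{n,k}(K)` (the zero measure). [folklore] -/
theorem zero_mem_momentCone : (0 : ↥T → ℝ) ∈ 𝓡 :=
  ⟨0, by simp, fun _ => ⟨integrable_zero_measure, by simp⟩⟩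

/-- `𝓡_{n,k}(K)` is closed under addition (sum of the representing measures). [folklore] -/
theorem add_mem_momentCone {w₁ w₂ : ↥T → ℝ} (h₁ : w₁ ∈ 𝓡) (h₂ : w₂ ∈ 𝓡) : w₁ + w₂ ∈ 𝓡 := by
  obtain ⟨μ₁, hK₁, h₁⟩ := h₁
  obtain ⟨μ₂, hK₂, h₂⟩ := h₂
  refine ⟨μ₁ + μ₂, by simp [hK₁, hK₂], fun α => ⟨(h₁ α).1.add_measure (h₂ α).1, ?_⟩⟩
  rw [integral_add_measure (h₁ α).1 (h₂ α).1, (h₁ α).2, (h₂ α).2, Pi.add_apply]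

/-- `𝓡_{n,k}(K)` is closed under non-negative scaling. [folklore] -/
theorem smul_mem_momentCone {w : ↥T → ℝ} {t : ℝ} (ht : 0 ≤ t) (h : w ∈ 𝓡) : t • w ∈ 𝓡 := by
  obtain ⟨μ, hK, h⟩ := h
  refine ⟨ENNReal.ofReal t • μ, by simp [hK], fun α =>
    ⟨(h α).1.smul_measure ENNReal.ofReal_ne_top, ?_⟩⟩
  rw [integral_smul_measure, (h α).2, ENNReal.toReal_ofReal ht, Pi.smul_apply]

/-- `𝓡_{n,k}(K)` is a convex cone (op. cit. §2, first paragraph). [cite: FialkowNie2010, §2] -/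
theorem convex_momentCone : Convex ℝ 𝓡 := by
  intro w₁ h₁ w₂ h₂ a b ha hb _
  exact add_mem_momentCone (smul_mem_momentCone ha h₁) (smul_mem_momentCone hb h₂)

/-- For `x ∈ K`, `[x]_k ∈ 𝓡_{n,k}(K)`, `δ_x` being a `K`-representing measure (op. cit. §2).
[cite: FialkowNie2010, §2] -/
theorem momentVec_mem_momentCone {x : Fin n → ℝ} (hx : x ∈ K) : 𝐯[x] ∈ 𝓡 := by
  refine ⟨Measure.dirac x, ?_, fun α => ⟨integrable_dirac (by simp), ?_⟩⟩
  · rw [Measure.dirac_apply, Set.indicator_of_notMem (Set.notMem_compl_iff.mpr hx)]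
  · exact integral_dirac _ _

/-- **Theorem 2.2 (i ⇒ iii)** of Fialkow–Nie: a `K`-positive sequence lies in the closure of
`𝓡_{n,k}(K)` — Minkowski separation from the closed convex cone `cl 𝓡`, the separating functional
read as a polynomial non-negative on `K`. [cite: FialkowNie2010, Thm 2.2] -/
theorem mem_closure_momentCone {w : ↥T → ℝ} (hw : ∀ c ∈ 𝓒, 0 ≤ c ⬝ᵥ w) : w ∈ closure 𝓡 := by
  by_contra hnot
  obtain ⟨f, u, hfu, hub⟩ := geometric_hahn_banach_point_closed
    (convex_momentCone (T := T) (K := K)).closure isClosed_closure hnot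
  have hu : u < 0 := by simpa using hub 0 (subset_closure zero_mem_momentCone)
  have hf : ∀ b ∈ 𝓡, 0 ≤ f b := by
    intro b hb
    by_contra hfb
    push Not at hfb
    have key := hub ((u / f b) • b)
      (subset_closure (smul_mem_momentCone (div_nonneg_of_nonpos hu.le hfb.le) hb))
    rw [map_smul, smul_eq_mul, div_mul_cancel₀ _ hfb.ne] at key
    exact lt_irrefl _ key
  set c : ↥T → ℝ := fun α => f (fun β => if α = β then 1 else 0) with hc
  have hfc : ∀ w', f w' = c ⬝ᵥ w' := by
    intro w'
    have key := LinearMap.pi_apply_eq_sum_univ (f : (↥T → ℝ) →ₗ[ℝ] ℝ) w'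
    simp only [ContinuousLinearMap.coe_coe, smul_eq_mul] at key
    rw [key, dotProduct]
    exact Finset.sum_congr rfl fun α _ => mul_comm _ _
  have hcmem : c ∈ 𝓒 := fun x hx => by
    rw [← hfc]
    exact hf _ (momentVec_mem_momentCone hx)
  have key := hw c hcmem
  rw [← hfc] at key
  linarith

/-- **Lemma 2.3** of Fialkow–Nie (openness of strict `K`-positivity; the determining hypothesis
enters as `c ≠ 0 ⇒ ⟨c, y₀⟩ > 0`): every sequence near `y₀` is `K`-positive. Compactness of
`𝓒 ∩ {‖c‖ = 1}` as printed, packaged by the tube lemma. [cite: FialkowNie2010, Lemma 2.3] -/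
theorem eventually_kPositive {y₀ : ↥T → ℝ} (hstrict : ∀ c ∈ 𝓒, c ≠ 0 → 0 < c ⬝ᵥ y₀) :
    ∀ᶠ w in 𝓝 y₀, ∀ c ∈ 𝓒, 0 ≤ c ⬝ᵥ w := by
  have hclosed : IsClosed 𝓒 := by
    have heq : 𝓒 = ⋂ x ∈ K, {c : ↥T → ℝ | 0 ≤ c ⬝ᵥ 𝐯[x]} := by
      ext c
      simp
    rw [heq]
    exact isClosed_biInter fun x _ =>
      isClosed_le continuous_const (continuous_id.dotProduct continuous_const)
  have hcpt : IsCompact (𝓒 ∩ sphere 0 1) := (isCompact_sphere (0 : ↥T → ℝ) 1).inter_left hclosed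
  have hev : ∀ᶠ w in 𝓝 y₀, ∀ c ∈ 𝓒 ∩ sphere 0 1, 0 < c ⬝ᵥ w := by
    apply hcpt.eventually_forall_of_forall_eventually (P := fun w c => 0 < c ⬝ᵥ w)
    rintro c ⟨hc, hcs⟩
    have hc0 : c ≠ 0 := by
      rintro rfl
      simp at hcs
    have hcont : Continuous fun z : (↥T → ℝ) × (↥T → ℝ) => z.2 ⬝ᵥ z.1 :=
      continuous_snd.dotProduct continuous_fst
    exact (hcont.tendsto (y₀, c)).eventually (lt_mem_nhds (hstrict c hc hc0))
  filter_upwards [hev] with w hw c hc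
  by_cases hc0 : c = 0
  · rw [hc0, zero_dotProduct]
  · have hn : 0 < ‖c‖ := norm_pos_iff.mpr hc0
    have hmem : ‖c‖⁻¹ • c ∈ 𝓒 ∩ sphere 0 1 := by
      refine ⟨fun x hx => ?_, ?_⟩
      · rw [smul_dotProduct, smul_eq_mul]
        exact mul_nonneg (inv_nonneg.mpr hn.le) (hc x hx)
      · simp [norm_smul, inv_mul_cancel₀ hn.ne']
    have key := hw _ hmem
    rw [smul_dotProduct, smul_eq_mul] at key
    exact ((mul_pos_iff_of_pos_left (inv_pos.mpr hn)).mp key).le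

/-- **Lemma 2.1** of Fialkow–Nie in the form used (finite-dimensional `V`, convex `C ⊆ V`): a point
with a ball around it inside `cl C` belongs to `C`, i.e. `int cl C = int C ⊆ C`.
[cite: FialkowNie2010, Lemma 2.1] -/
theorem mem_of_ball_subset_closure {V : Type*} [NormedAddCommGroup V] [NormedSpace ℝ V]
    [FiniteDimensional ℝ V] {C : Set V} (hC : Convex ℝ C) {y₀ : V} {ε : ℝ} (hε : 0 < ε)
    (h : ball y₀ ε ⊆ closure C) : y₀ ∈ C := by
  have hy : y₀ ∈ interior (closure C) :=
    interior_mono h (by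
      rw [isOpen_ball.interior_eq]
      exact mem_ball_self hε)
  have hspan' : affineSpan ℝ (closure C) = ⊤ :=
    hC.closure.interior_nonempty_iff_affineSpan_eq_top.mp ⟨y₀, hy⟩
  have hspan : affineSpan ℝ C = ⊤ := by
    refine le_antisymm le_top ?_
    rw [← hspan']
    exact affineSpan_le_of_subset_coe
      (closure_minimal (subset_affineSpan ℝ C) (AffineSubspace.closed_of_finiteDimensional _))
  have hint : (interior C).Nonempty := hC.interior_nonempty_iff_affineSpan_eq_top.mpr hspan
  rw [hC.interior_closure_eq_interior_of_nonempty_interior hint] at hy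
  exact interior_subset hy

/-- Coefficients of `Σ_{α ∈ T} c_α x^α`. [folklore] -/
theorem coeff_sum_monomial (c : ↥T → ℝ) (β : Fin n →₀ ℕ) :
    (∑ α : ↥T, MvPolynomial.monomial α.1 (c α)).coeff β = if h : β ∈ T then c ⟨β, h⟩ else 0 := by
  classical
  simp only [MvPolynomial.coeff_sum, MvPolynomial.coeff_monomial]
  split_ifs with h
  · rw [Finset.sum_eq_single ⟨β, h⟩]
    · simp
    · intro α _ hne
      rw [if_neg]
      exact fun heq => hne (Subtype.ext heq)
    · simp
  · refine Finset.sum_eq_zero fun α _ => ?_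
    rw [if_neg]
    rintro rfl
    exact h α.2

/-- `deg (Σ_{α ∈ T} c_α x^α) ≤ k` when `T` consists of multi-indices of degree `≤ k`. [folklore] -/
theorem totalDegree_sum_monomial_le {k : ℕ} (hT : ∀ α ∈ T, (α.sum fun _ e => e) ≤ k)
    (c : ↥T → ℝ) : (∑ α : ↥T, MvPolynomial.monomial α.1 (c α)).totalDegree ≤ k := by
  refine MvPolynomial.totalDegree_finsetSum_le fun α _ => ?_
  exact (MvPolynomial.totalDegree_monomial_le _ _).trans (hT α.1 α.2)

/-- Evaluation: `(Σ_{α ∈ T} c_α x^α)(x) = ⟨c, [x]_T⟩`. [folklore] -/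
theorem eval_sum_monomial (c : ↥T → ℝ) (x : Fin n → ℝ) :
    MvPolynomial.eval x (∑ α : ↥T, MvPolynomial.monomial α.1 (c α)) = c ⬝ᵥ 𝐯[x] := by
  simp only [map_sum, MvPolynomial.eval_monomial, Finsupp.prod_pow]
  rfl

/-- The Riesz functional: `L_y(Σ_{α ∈ T} c_α x^α) = ⟨c, y|_T⟩`. [folklore] -/
theorem riesz_sum_monomial (c : ↥T → ℝ) (y : (Fin n →₀ ℕ) → ℝ) :
    ∑ β ∈ (∑ α : ↥T, MvPolynomial.monomial α.1 (c α)).support,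
      (∑ α : ↥T, MvPolynomial.monomial α.1 (c α)).coeff β * y β = c ⬝ᵥ fun α => y α.1 := by
  have hsupp : (∑ α : ↥T, MvPolynomial.monomial α.1 (c α)).support ⊆ T := by
    intro β hβ
    rw [MvPolynomial.mem_support_iff, coeff_sum_monomial] at hβ
    by_contra h
    exact hβ (dif_neg h)
  rw [Finset.sum_subset hsupp (fun β _ hβ => by
    rw [MvPolynomial.notMem_support_iff.mp hβ, zero_mul]), ← Finset.sum_coe_sort, dotProduct]
  refine Finset.sum_congr rfl fun α _ => ?_
  rw [coeff_sum_monomial, dif_pos α.2]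

/-- Injectivity of `c ↦ Σ_{α ∈ T} c_α x^α`. [folklore] -/
theorem eq_zero_of_sum_monomial_eq_zero {c : ↥T → ℝ}
    (h : ∑ α : ↥T, MvPolynomial.monomial α.1 (c α) = 0) : c = 0 := by
  funext α
  have key := coeff_sum_monomial c α.1
  rw [h, MvPolynomial.coeff_zero, dif_pos α.2] at key
  simpa using key.symm

/-- The multi-indices `α ∈ ℤ₊ⁿ` with `|α| ≤ k` form a finite set. [folklore] -/
theorem exists_finset_degree_le (n k : ℕ) :
    ∃ T : Finset (Fin n →₀ ℕ), ∀ α, α ∈ T ↔ (α.sum fun _ e => e) ≤ k := by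
  refine ⟨(Finset.range (k + 1)).biUnion fun j =>
    (Finset.univ : Finset (Fin n)).finsuppAntidiag j, fun α => ?_⟩
  simp only [Finset.mem_biUnion, Finset.mem_range, Finset.mem_finsuppAntidiag',
    Finset.subset_univ, and_true]
  constructor
  · rintro ⟨j, hj, h⟩
    omega
  · intro h
    exact ⟨_, Nat.lt_succ_of_le h, rfl⟩

/-- **Fialkow–Nie 2010, Theorem 1.3 (= Theorem 2.4)**, proved: for a closed determining set `K`
of degree `k`, a truncated moment sequence of degree `k` whose Riesz functional is strictly
`K`-positive has a `K`-representing measure. Proof as printed in §2 of the source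
(`mem_closure_momentCone` = Thm 2.2, `eventually_kPositive` = Lemma 2.3,
`mem_of_ball_subset_closure` = Lemma 2.1); closedness of `K` is not used.
[cite: FialkowNie2010, Thm 1.3] -/
theorem FialkowNie2010_thm13_holds : FialkowNie2010_thm13 := by
  intro n k K _hK hdet y hpos hstrict
  obtain ⟨T, hT⟩ := exists_finset_degree_le n k
  have hTle : ∀ α ∈ T, (α.sum fun _ e => e) ≤ k := fun α hα => (hT α).mp hα
  -- the truncated sequence as a point of `ℝ^T`
  set y₀ : ↥T → ℝ := fun α => y α.1 with hy₀
  -- strict `K`-positivity, transported to coefficient vectors (uses: `K` determining)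
  have hstrict' : ∀ c : ↥T → ℝ, (∀ x ∈ K, 0 ≤ c ⬝ᵥ fun α : ↥T => ∏ i, x i ^ (α.1 i)) →
      c ≠ 0 → 0 < c ⬝ᵥ y₀ := by
    intro c hc hc0
    have hK0 : ∀ x ∈ K, 0 ≤ MvPolynomial.eval x (∑ α : ↥T, MvPolynomial.monomial α.1 (c α)) :=
      fun x hx => by
        rw [eval_sum_monomial]
        exact hc x hx
    have hne : ∃ x ∈ K, MvPolynomial.eval x (∑ α : ↥T, MvPolynomial.monomial α.1 (c α)) ≠ 0 := by
      by_contra hall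
      push Not at hall
      exact hc0 (eq_zero_of_sum_monomial_eq_zero
        (hdet _ (totalDegree_sum_monomial_le hTle c) hall))
    have key := hstrict _ (totalDegree_sum_monomial_le hTle c) hK0 hne
    rwa [riesz_sum_monomial] at key
  -- Lemma 2.3 + Theorem 2.2: a ball around `y₀` lies in the closure of the cone
  obtain ⟨ε, hε, hball⟩ := Metric.mem_nhds_iff.mp (eventually_kPositive hstrict')
  have hsub := fun w (hw : w ∈ ball y₀ ε) => mem_closure_momentCone (hball hw)
  -- Lemma 2.1: hence `y₀` is in the cone itself, i.e. has a `K`-representing measure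
  obtain ⟨μ, hμK, hμ⟩ := mem_of_ball_subset_closure (convex_momentCone (T := T) (K := K)) hε hsub
  exact ⟨μ, hμK, fun α hα => hμ ⟨α, (hT α).mpr hα⟩⟩

end FialkowNieProof

end Literature.MeasureTheory.Moments
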